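import Summits.CriticalPhenomena.PercolationContinuityZ3.Theorems.FK.InfiniteVolumeDefs
import Literature.Probability.LatticeModels.RandomClusterFiniteVolumePressure
import HarnessLib

/-!
# FK-continuity cell, FO-10a (pressure layer): edges of `ℤ^d` inside a box — `d |Λ_{N-m}| ≤ |E_{Λ_N}| ≤ d |Λ_N|`,
# `|E_{Λ_N}|/|Λ_N| → d`, and the mean number of open edges of a finite piece as a sum over its ambient edges

Registered R84 (cell INBOX l.6112, 2026-08-24); registry row FO-10a-g338d; label PRS-E (coordinator fk-4 g187).
Cell `fk-continuity` (bschramm), row FO-10a (domain-Markov + comparison layer over FO-06); support file for the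
FK-continuity transplant (`--supports stmt-CriticalPhenomena-4575`); builds on p205010 (kernel theorem, internal audit
signed; external expert review pending). Pure proofs; no definitions, no named facts, no sorries; general `d`.
UNCONDITIONAL lattice / finite-volume bookkeeping; it decides nothing about FH / TP_FK / the value of `p_c(q)`.

Tools for the identification of the `p`-derivatives of the random-cluster pressure with the edge densities (Grimmett 2006,
(4.72)–(4.76): "the `π`-derivative of `|E_Λ|⁻¹ log Y_Λ` is `|E_Λ|⁻¹ φ_Λ(|η|)`", and `|E_Λ|/|Λ| → d`):

* `coordEdge_eq_map_add`, `coordEdge_mem_edgeSet`, `coordEdge_zero_mem_edgeSet`, `siteRad_zero`, `siteRad_single`,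
  `pairRad_coordEdge_zero`, `pairRad_le_of_forall_mem_box`, `siteRad_add_single_le` — the coordinate edges `⟨x, x + eᵢ⟩`;
* `edgesIn_subset_image_coordEdge`, **`card_edgesIn_le_mul_card`** (`|E_Λ| ≤ d|Λ|` for every finite `Λ ⊆ ℤ^d`), `coordEdge_injective`,
  `coordEdge_mem_edgesIn_box`, **`card_box_mul_le_card_edgesIn_box`** (`d|Λ_{N-m}| ≤ |E_{Λ_N}|`, `1 ≤ m ≤ N`),
  `tendsto_card_box_sub_div_card_box` (`|Λ_{N-m}|/|Λ_N| → 1`), **`tendsto_card_edgesIn_box_div_card_box`** (`|E_{Λ_N}|/|Λ_N| → d`);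
* `edgeOpen_eq_eOpen`, `sum_edgeFinset_finsetGraph_eq_sum_edgesIn`, **`rcExpect_card_eq_sum_edgesIn`**
  (`E^B_{Λ,p,q}|ω| = ∑_{e ∈ E_Λ} φ^B_{Λ,p,q}(J_e)` over the ambient edges `E_Λ = edgesIn (zdGraph d) Λ`, from Literature
  `rcExpect_card_eq_sum_real_edgeOpen`), `card_edgeFinset_finsetGraph_eq_card_edgesIn`, **`tendsto_card_edgeFinset_box_div_card_box`**.

Honest framing: lattice bookkeeping; no statement about `p_c(q)`; NOT a binder discharge, NOT `_r4`.

## References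

* G. Grimmett, *The Random-Cluster Model*, Springer 2006 (`book:grimmett2006-random-cluster-model`): §4.5, (4.61), proof of
  Thm. (4.63), (4.72)–(4.76) [PDF pp. 89–93]. [Grimmett2006]
-/

noncomputable section

open Finset Filter Topology

namespace Summit.CriticalPhenomena.PercolationContinuityZ3.Theorems.FK

open Literature.Probability.Percolation Literature.Probability.LatticeModels

variable {d : ℕ}

/-! ### Lattice bookkeeping: coordinate edges, edges inside a box -/

section Lattice

/-- The coordinate edge `⟨x, x + eᵢ⟩` is the translate by `x` of `⟨0, eᵢ⟩`. [folklore] -/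
theorem coordEdge_eq_map_add (x : Site d) (i : Fin d) :
    s(x, x + Pi.single i 1) = Sym2.map (· + x) s((0 : Site d), Pi.single i 1) := by
  rw [Sym2.map_mk, zero_add, add_comm]

/-- `⟨x, x + eᵢ⟩` is an edge of `ℤ^d`. [folklore] -/
theorem coordEdge_mem_edgeSet (x : Site d) (i : Fin d) : s(x, x + Pi.single i 1) ∈ (zdGraph d).edgeSet := by
  rw [SimpleGraph.mem_edgeSet, zdGraph_adj_iff]
  exact ⟨i, Or.inl rfl⟩

/-- `⟨0, eᵢ⟩` is an edge of `ℤ^d`. [folklore] -/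
theorem coordEdge_zero_mem_edgeSet (i : Fin d) : s((0 : Site d), Pi.single i 1) ∈ (zdGraph d).edgeSet := by
  have h := coordEdge_mem_edgeSet (0 : Site d) i
  rwa [zero_add] at h

/-- `‖0‖_∞ = 0`. [folklore] -/
@[simp] theorem siteRad_zero : siteRad (0 : Site d) = 0 := by
  simp [siteRad]

/-- `‖eᵢ‖_∞ = 1`. [folklore] -/
theorem siteRad_single (i : Fin d) : siteRad (Pi.single i (1 : ℤ) : Site d) = 1 := by
  refine le_antisymm ?_ ?_
  · rw [siteRad, Finset.sup_le_iff]
    intro j _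
    rcases eq_or_ne j i with rfl | hji
    · simp
    · simp [Pi.single_eq_of_ne hji]
  · have h := Finset.le_sup (f := fun j => ((Pi.single i (1 : ℤ) : Site d) j).natAbs) (Finset.mem_univ i)
    simpa [siteRad] using h

/-- The coordinate edge at the origin has radius `1`. [folklore] -/
theorem pairRad_coordEdge_zero (i : Fin d) : pairRad s((0 : Site d), Pi.single i 1) = 1 := by
  rw [pairRad_mk, siteRad_zero, siteRad_single, Nat.zero_max]

/-- A pair with both points in `Λ_n` has radius `≤ n` (converse of `mem_box_of_pairRad_le`). [folklore] -/
theorem pairRad_le_of_forall_mem_box {e : Sym2 (Site d)} {n : ℕ} (h : ∀ z ∈ e, z ∈ box d n) : pairRad e ≤ n := by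
  induction e using Sym2.ind with
  | h x y =>
    rw [pairRad_mk, max_le_iff]
    exact ⟨mem_box_iff_siteRad_le.1 (h x (Sym2.mem_mk_left x y)), mem_box_iff_siteRad_le.1 (h y (Sym2.mem_mk_right x y))⟩

/-- **Every edge of `ℤ^d` inside `Λ` is a coordinate edge `⟨x, x + eᵢ⟩` with `x ∈ Λ`.** [folklore] -/
theorem edgesIn_subset_image_coordEdge (Λ : Finset (Site d)) :
    edgesIn (zdGraph d) Λ ⊆
      (Λ ×ˢ (Finset.univ : Finset (Fin d))).image (fun xi => s(xi.1, xi.1 + Pi.single xi.2 1)) := by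
  intro e he
  rw [mem_edgesIn_iff] at he
  obtain ⟨he, hΛ⟩ := he
  obtain ⟨i, x, rfl⟩ := exists_eq_map_add_of_mem_edgeSet he
  refine Finset.mem_image.2 ⟨(x, i), Finset.mem_product.2 ⟨hΛ x ?_, Finset.mem_univ _⟩, ?_⟩
  · rw [Sym2.map_mk, zero_add]
    exact Sym2.mem_mk_left _ _
  · exact coordEdge_eq_map_add x i

/-- `|E_Λ| ≤ d |Λ|` for every finite `Λ ⊆ ℤ^d`. [folklore] -/
theorem card_edgesIn_le_mul_card (Λ : Finset (Site d)) : #(edgesIn (zdGraph d) Λ) ≤ d * #Λ := by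
  refine (Finset.card_le_card (edgesIn_subset_image_coordEdge Λ)).trans (Finset.card_image_le.trans ?_)
  rw [Finset.card_product, Finset.card_univ, Fintype.card_fin, mul_comm]

/-- `(x, i) ↦ ⟨x, x + eᵢ⟩` is injective. [folklore] -/
theorem coordEdge_injective :
    Function.Injective (fun xi : Site d × Fin d => s(xi.1, xi.1 + Pi.single xi.2 1)) := by
  rintro ⟨x, i⟩ ⟨y, j⟩ h
  have h' : s(x, x + Pi.single i 1) = s(y, y + Pi.single j 1) := h
  rw [Sym2.eq_iff] at h'
  rcases h' with ⟨hxy, h2⟩ | ⟨h1, h2⟩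
  · subst hxy
    have hs : (Pi.single i (1 : ℤ) : Site d) = Pi.single j 1 := add_left_cancel h2
    have hij : i = j := by
      by_contra hne
      have := congr_fun hs i
      rw [Pi.single_eq_same, Pi.single_eq_of_ne hne] at this
      exact one_ne_zero this
    subst hij
    rfl
  · exfalso
    have hs : (Pi.single j (1 : ℤ) : Site d) + Pi.single i 1 = 0 := by
      have h3 : y + (Pi.single j 1 + Pi.single i 1) = y + 0 := by rw [← add_assoc, ← h1, h2, add_zero]
      exact add_left_cancel h3
    have hi := congr_fun hs i
    rw [Pi.add_apply, Pi.single_eq_same, Pi.zero_apply] at hi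
    rcases eq_or_ne i j with rfl | hij
    · rw [Pi.single_eq_same] at hi
      omega
    · rw [Pi.single_eq_of_ne hij] at hi
      omega

/-- `‖x + eᵢ‖_∞ ≤ ‖x‖_∞ + 1`. [folklore] -/
theorem siteRad_add_single_le (x : Site d) (i : Fin d) : siteRad (x + Pi.single i 1) ≤ siteRad x + 1 := by
  have h := siteRad_add_le x (Pi.single i 1)
  rwa [siteRad_single] at h

/-- **Deep coordinate edges lie inside the box**: for `x ∈ Λ_{N-m}` with `1 ≤ m ≤ N`, `⟨x, x + eᵢ⟩ ∈ E_{Λ_N}`. [folklore] -/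
theorem coordEdge_mem_edgesIn_box {N m : ℕ} (hm : 1 ≤ m) (hmN : m ≤ N) {x : Site d} (hx : x ∈ box d (N - m))
    (i : Fin d) : s(x, x + Pi.single i 1) ∈ edgesIn (zdGraph d) (box d N) := by
  rw [mem_edgesIn_iff]
  refine ⟨coordEdge_mem_edgeSet x i, fun z hz => ?_⟩
  rw [mem_box_iff_siteRad_le] at hx ⊢
  rcases Sym2.mem_iff.1 hz with rfl | rfl
  · omega
  · have := siteRad_add_single_le x i
    omega

/-- `d |Λ_{N-m}| ≤ |E_{Λ_N}|` for `1 ≤ m ≤ N` (the deep coordinate edges are distinct edges of `Λ_N`). [folklore] -/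
theorem card_box_mul_le_card_edgesIn_box {N m : ℕ} (hm : 1 ≤ m) (hmN : m ≤ N) :
    d * #(box d (N - m)) ≤ #(edgesIn (zdGraph d) (box d N)) := by
  classical
  have h := Finset.card_le_card (show (box d (N - m) ×ˢ (Finset.univ : Finset (Fin d))).image
      (fun xi => s(xi.1, xi.1 + Pi.single xi.2 1)) ⊆ edgesIn (zdGraph d) (box d N) from ?_)
  · rwa [Finset.card_image_of_injective _ coordEdge_injective, Finset.card_product, Finset.card_univ,
      Fintype.card_fin, mul_comm] at h
  · intro e he
    rw [Finset.mem_image] at he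
    obtain ⟨⟨x, i⟩, hxi, rfl⟩ := he
    exact coordEdge_mem_edgesIn_box hm hmN (Finset.mem_product.1 hxi).1 i

/-- `|Λ_{N-m}| / |Λ_N| → 1` as `N → ∞` (`m` fixed). [folklore] -/
theorem tendsto_card_box_sub_div_card_box (m : ℕ) :
    Tendsto (fun N : ℕ => (#(box d (N - m)) : ℝ) / #(box d N)) atTop (𝓝 1) := by
  have h0 : Tendsto (fun N : ℕ => 2 * (N : ℝ) + 1) atTop atTop :=
    tendsto_atTop_mono (fun N => by linarith [(Nat.cast_nonneg N : (0 : ℝ) ≤ N)]) tendsto_natCast_atTop_atTop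
  have h1 : Tendsto (fun N : ℕ => (1 - 2 * (m : ℝ) / (2 * (N : ℝ) + 1)) ^ d) atTop (𝓝 1) := by
    have h := ((tendsto_const_nhds (x := (1 : ℝ))).sub
      ((tendsto_const_nhds (x := 2 * (m : ℝ))).div_atTop h0)).pow d
    rwa [sub_zero, one_pow] at h
  refine h1.congr' ?_
  filter_upwards [eventually_ge_atTop m] with N hN
  have hpos : (0 : ℝ) < 2 * (N : ℝ) + 1 := by positivity
  rw [card_box, card_box, Nat.cast_pow, Nat.cast_pow, ← div_pow]
  congr 1
  have hsub : ((2 * (N - m) + 1 : ℕ) : ℝ) = 2 * (N : ℝ) + 1 - 2 * m := by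
    push_cast [Nat.cast_sub hN]
    ring
  rw [hsub]
  field_simp
  push_cast
  ring

/-- **`|E_{Λ_N}| / |Λ_N| → d`** (the number of edges per site of `ℤ^d`). [folklore] -/
theorem tendsto_card_edgesIn_box_div_card_box :
    Tendsto (fun N : ℕ => (#(edgesIn (zdGraph d) (box d N)) : ℝ) / #(box d N)) atTop (𝓝 (d : ℝ)) := by
  have hlo : Tendsto (fun N : ℕ => (d : ℝ) * ((#(box d (N - 1)) : ℝ) / #(box d N))) atTop (𝓝 (d : ℝ)) := by
    have h := (tendsto_card_box_sub_div_card_box (d := d) 1).const_mul (d : ℝ)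
    rwa [mul_one] at h
  refine tendsto_of_tendsto_of_tendsto_of_le_of_le' hlo tendsto_const_nhds ?_ ?_
  · filter_upwards [eventually_ge_atTop 1] with N hN
    have hpos : (0 : ℝ) < #(box d N) := by exact_mod_cast Finset.card_pos.2 (box_nonempty d N)
    rw [← mul_div_assoc, div_le_div_iff_of_pos_right hpos]
    exact_mod_cast card_box_mul_le_card_edgesIn_box (d := d) le_rfl hN
  · filter_upwards with N
    have hpos : (0 : ℝ) < #(box d N) := by exact_mod_cast Finset.card_pos.2 (box_nonempty d N)
    rw [div_le_iff₀ hpos]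
    exact_mod_cast card_edgesIn_le_mul_card (box d N)

end Lattice

/-! ### The mean number of open edges as a sum of ambient edge probabilities -/

section Mean

/-- The event "the edge `e'` of the piece `Λ` is open" is `eOpen Λ e` of the ambient pair `e = val(e')`. [cite: Grimmett2006, (4.61)] -/
theorem edgeOpen_eq_eOpen (Λ : Finset (Site d)) (e' : Sym2 ↥Λ) : edgeOpen e' = eOpen Λ (Sym2.map Subtype.val e') := by
  ext ω
  rw [mem_edgeOpen_iff, mem_eOpen_iff]
  constructor
  · intro h
    exact ⟨e', h, rfl⟩
  · rintro ⟨e'', h, he⟩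
    rwa [← Sym2.map.injective Subtype.val_injective he]

/-- Reindexing the edges of the piece `(Λ, E_Λ)` by the ambient edges `E_Λ ⊆ E(ℤ^d)`. [folklore] -/
theorem sum_edgeFinset_finsetGraph_eq_sum_edgesIn (Λ : Finset (Site d)) (F : Sym2 (Site d) → ℝ) :
    ∑ e' ∈ (finsetGraph (zdGraph d) Λ).edgeFinset, F (Sym2.map Subtype.val e') = ∑ e ∈ edgesIn (zdGraph d) Λ, F e := by
  refine Finset.sum_nbij (fun e' => Sym2.map Subtype.val e') (fun e' he' => ?_)
    (fun a _ b _ h => Sym2.map.injective Subtype.val_injective h) (fun e he => ?_) (fun _ _ => rfl)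
  · induction e' using Sym2.ind with
    | h u v =>
      rw [SimpleGraph.mem_edgeFinset, SimpleGraph.mem_edgeSet] at he'
      rw [Sym2.map_mk, mem_edgesIn_iff]
      refine ⟨he', fun z hz => ?_⟩
      rcases Sym2.mem_iff.1 hz with rfl | rfl
      · exact u.2
      · exact v.2
  · rw [Finset.mem_coe, mem_edgesIn_iff] at he
    induction e using Sym2.ind with
    | h x y =>
      refine ⟨s(⟨x, he.2 x (Sym2.mem_mk_left x y)⟩, ⟨y, he.2 y (Sym2.mem_mk_right x y)⟩), ?_, by simp⟩
      rw [Finset.mem_coe, SimpleGraph.mem_edgeFinset, SimpleGraph.mem_edgeSet]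
      exact he.1

/-- **The mean number of open edges of the piece `Λ ⊆ ℤ^d` is the sum of the edge probabilities over the ambient edges**:
`E^B_{Λ,p,q}|ω| = ∑_{e ∈ E_Λ} φ^B_{Λ,p,q}(J_e)` (Grimmett 2006, (4.72)–(4.75)). [cite: Grimmett2006, proof of Thm. (4.63), (4.73)–(4.75)] -/
theorem rcExpect_card_eq_sum_edgesIn {p q : ℝ} (hp : p ∈ Set.Icc (0 : ℝ) 1) (hq : 0 < q) (Λ : Finset (Site d))
    (B : Set ↥Λ) :
    rcExpect (finsetGraph (zdGraph d) Λ) p q B (fun ω => (#ω : ℝ)) =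
      ∑ e ∈ edgesIn (zdGraph d) Λ, (rcMeasure (finsetGraph (zdGraph d) Λ) p q B).real (eOpen Λ e) := by
  rw [rcExpect_card_eq_sum_real_edgeOpen _ hp hq B,
    ← sum_edgeFinset_finsetGraph_eq_sum_edgesIn Λ (fun e => (rcMeasure (finsetGraph (zdGraph d) Λ) p q B).real (eOpen Λ e))]
  refine Finset.sum_congr rfl fun e' _ => ?_
  rw [edgeOpen_eq_eOpen]

/-- The piece `(Λ, E_Λ)` has `|E_Λ|` edges: `#(finsetGraph (zdGraph d) Λ).edgeFinset = #(edgesIn (zdGraph d) Λ)`. [folklore] -/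
theorem card_edgeFinset_finsetGraph_eq_card_edgesIn (Λ : Finset (Site d)) :
    #(finsetGraph (zdGraph d) Λ).edgeFinset = #(edgesIn (zdGraph d) Λ) := by
  have h := sum_edgeFinset_finsetGraph_eq_sum_edgesIn Λ (fun _ => (1 : ℝ))
  rw [Finset.sum_const, Finset.sum_const, nsmul_eq_mul, nsmul_eq_mul, mul_one, mul_one] at h
  exact_mod_cast h

/-- **`|E(Λ_N, E_{Λ_N})| / |Λ_N| → d`**, stated for the edge set of the piece `finsetGraph (zdGraph d) (box d N)` (the form in which the
edge count enters the tangent inequality of the finite-volume pressure, Literature `log_rcPartitionFunction_sub_ge`). [folklore] -/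
theorem tendsto_card_edgeFinset_box_div_card_box :
    Tendsto (fun N : ℕ => (#(finsetGraph (zdGraph d) (box d N)).edgeFinset : ℝ) / #(box d N)) atTop (𝓝 (d : ℝ)) := by
  refine (tendsto_card_edgesIn_box_div_card_box (d := d)).congr fun N => ?_
  rw [card_edgeFinset_finsetGraph_eq_card_edgesIn]

end Mean

end Summit.CriticalPhenomena.PercolationContinuityZ3.Theorems.FK
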